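import Literature.NumberTheory.Sieve.SmoothTwistedSaddleWindow
import Literature.NumberTheory.Sieve.SmoothSaddleKernelWindow2
import Literature.NumberTheory.Sieve.TwistedWeightMellinSecondDiff
import HarnessLib

/-!
# The twisted saddle point at the scales `x/e`, parametric window, SECOND order

Topic `Literature/NumberTheory/Sieve`; a PROVED file sharpening `SmoothTwistedSaddleWindow`
([HildebrandTenenbaum1986, §4 (Lemmas 10–11)], [Harper2016, §5]). With `W_λ(v) = v²(1−v)²e(λv)`,
`α = α(x,y)`, `φ = φ₂(α,y)`, `𝓜 = x^α ζ(α,y)/√(2πφ)` and the scaled kernel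
`A_{λ,e}(t) = e^{−(α+it)} Ŵ_λ(α+it)` of `SmoothTwistedSaddle`, the kernel bounds are
`B₀ = 2e^{−α}/(1+|λ|)`, `B₁ = (2 + 2 log e)e^{−α}/(1+|λ|)`, `B_a = e^{−α}`, `B₃ = e^{−α}C_λ` (tree) and the
NEW second symmetric difference `‖A(t) + A(−t) − 2A(0)‖ ≤ B₂t²`, `B₂ = 2(log e + 3)² e^{−α}/(1+|λ|)`
(`scaledKernel_symmDiff_le`, from `TwistedWeight.norm_twistMellin_symmDiff_le`). The second-order
kernel estimate `SaddleKernel.norm_kernelIntegral_sub_main_le_window₂'` then gives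

`norm_scaledSum_sub_main_le_window₂`: `‖S_w(λ; x/e) − e^{−α} 𝓜 Ŵ_λ(α)‖ ≤ (x^αζ(α,y)/(2π)) e^{−α} · E₂`,

where `E₂` is the bracket of `norm_scaledSum_sub_main_le_window` with its window term
`(2950 log y + 8 + 8 log e)/(φ(1+|λ|))` (relative size `log y/√φ ≍ √(log y/log x)` against `𝓜/(1+|λ|)`)
replaced by `√(4π/φ)(2(log e+3)² + (2+2 log e)(15ℓ + 666ℓ²W/√φ) + 916ℓ² + 7·10⁶ℓ⁴/φ)/(φ(1+|λ|))`
(`ℓ = log y`; relative size `O((ℓ² + ℓ log e + log² e)/φ) = O((log y + log² e/log y)/log x)`). This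
is what a QUANTITATIVE precision `O_B(log y/log x)` at the scalings `e ≤ (log x)^B` requires
(`SmoothTwistedSaddleWindowQuant`).

## References

* A. Hildebrand, G. Tenenbaum, Trans. AMS 296 (1986), §4 (Lemmas 10–11) [HildebrandTenenbaum1986].
* A. J. Harper, Compositio Math. 152 (2016), §5 [Harper2016].
-/

noncomputable section

open Real Complex MeasureTheory Set Filter
open scoped FourierTransform Topology

namespace Literature.NumberTheory.Sieve

namespace TwistedWeight

/-! ### The scaled kernel: the five bounds -/

/-- `‖e^{−it log e'} + e^{it log e'} − 2‖ ≤ (t log e')²` for `e' ≥ 1`. [folklore] -/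
theorem norm_natCast_cpow_symm_sub_two_le {e : ℕ} (he : 1 ≤ e) (t : ℝ) :
    ‖(e : ℂ) ^ (-((t : ℂ) * I)) + (e : ℂ) ^ (-((((-t : ℝ)) : ℂ) * I)) - 2‖ ≤ (t * Real.log e) ^ 2 := by
  have he0 : (0 : ℝ) < e := by exact_mod_cast he
  have he0' : (e : ℂ) ≠ 0 := by exact_mod_cast he0.ne'
  have h1 : (e : ℂ) ^ (-((t : ℂ) * I)) = Complex.exp (-((((t * Real.log e : ℝ)) : ℂ) * I)) := by
    rw [Complex.cpow_def_of_ne_zero he0', ← Complex.ofReal_natCast, ← Complex.ofReal_log he0.le]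
    congr 1; push_cast; ring
  have h2 : (e : ℂ) ^ (-((((-t : ℝ)) : ℂ) * I)) = Complex.exp ((((t * Real.log e : ℝ)) : ℂ) * I) := by
    rw [Complex.cpow_def_of_ne_zero he0', ← Complex.ofReal_natCast, ← Complex.ofReal_log he0.le]
    congr 1; push_cast; ring
  have e1 : Complex.exp (-((((t * Real.log e : ℝ)) : ℂ) * I)) + Complex.exp ((((t * Real.log e : ℝ)) : ℂ) * I) - 2 =
      Complex.exp ((((t * Real.log e : ℝ)) : ℂ) * I) + Complex.exp (-((((t * Real.log e : ℝ)) : ℂ) * I)) - 2 := by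
    ring
  rw [h1, h2, e1]
  exact norm_exp_mul_I_add_exp_neg_sub_two_le _

/-- `e^{−(α+iu)} = e^{−α} e^{−iu}` (as complex powers of `e ≥ 1`). [folklore] -/
theorem natCast_cpow_neg_add {e : ℕ} (he : 1 ≤ e) (α u : ℝ) :
    (e : ℂ) ^ (-((α : ℂ) + u * I)) = (e : ℂ) ^ (-(α : ℂ)) * (e : ℂ) ^ (-((u : ℂ) * I)) := by
  have he0c : (e : ℂ) ≠ 0 := by exact_mod_cast (show 0 < e from he).ne'
  rw [neg_add, Complex.cpow_add _ _ he0c]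

/-- `A_{λ,e}(0) = e^{−α} Ŵ_λ(α)`. [folklore] -/
theorem scaledKernel_zero {α : ℝ} {e : ℕ} (he : 1 ≤ e) (lam : ℝ) :
    scaledKernel α e lam 0 = ((((e : ℝ) ^ (-α) : ℝ)) : ℂ) * twistMellin lam α := by
  have he0' : (0 : ℝ) ≤ (e : ℝ) := by positivity
  simp only [scaledKernel]
  push_cast
  rw [zero_mul, add_zero, Complex.ofReal_cpow he0']
  push_cast
  rfl

/-- `‖A_{λ,e}(t)‖ ≤ 2e^{−α}/(1+|λ|)` for `|t| ≤ 3` (`0 < α ≤ 1`). [folklore] -/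
theorem scaledKernel_norm_le_three {α : ℝ} (hα0 : 0 < α) (hα1 : α ≤ 1) {e : ℕ} (he : 1 ≤ e) (lam : ℝ)
    {t : ℝ} (ht : |t| ≤ 3) : ‖scaledKernel α e lam t‖ ≤ 2 * (e : ℝ) ^ (-α) / (1 + |lam|) := by
  rw [norm_scaledKernel he]
  calc (e : ℝ) ^ (-α) * ‖twistMellin lam (α + t * I)‖ ≤ (e : ℝ) ^ (-α) * (2 / (1 + |lam|)) :=
        mul_le_mul_of_nonneg_left (norm_twistMellin_le_two_div hα0 hα1 ht lam) (by positivity)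
    _ = 2 * (e : ℝ) ^ (-α) / (1 + |lam|) := by ring

/-- `‖A_{λ,e}(t)‖ ≤ e^{−α}` for all `t` (`α > 0`). [folklore] -/
theorem scaledKernel_norm_le {α : ℝ} (hα0 : 0 < α) {e : ℕ} (he : 1 ≤ e) (lam t : ℝ) :
    ‖scaledKernel α e lam t‖ ≤ (e : ℝ) ^ (-α) := by
  rw [norm_scaledKernel he]
  calc (e : ℝ) ^ (-α) * ‖twistMellin lam (α + t * I)‖ ≤ (e : ℝ) ^ (-α) * 1 :=
        mul_le_mul_of_nonneg_left (norm_twistMellin_le_one (by simp; exact hα0.le) lam) (by positivity)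
    _ = (e : ℝ) ^ (-α) := mul_one _

/-- `‖A_{λ,e}(t)‖ ≤ e^{−α} C_λ/|t|³` for `|t| > T ≥ 3` (`α > 0`), `C_λ = 2 + 6(2π|λ|) + 6(2π|λ|)² + (2π|λ|)³`.
[folklore] -/
theorem scaledKernel_decay {α : ℝ} (hα0 : 0 < α) {e : ℕ} (he : 1 ≤ e) (lam : ℝ) {T t : ℝ} (hT : 3 ≤ T)
    (ht : T < |t|) :
    ‖scaledKernel α e lam t‖ ≤ (e : ℝ) ^ (-α) *
      (2 + 6 * (2 * π * |lam|) + 6 * (2 * π * |lam|) ^ 2 + (2 * π * |lam|) ^ 3) / |t| ^ 3 := by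
  have hCl0 : 0 ≤ 2 + 6 * (2 * π * |lam|) + 6 * (2 * π * |lam|) ^ 2 + (2 * π * |lam|) ^ 3 := by
    have := Real.pi_pos; positivity
  have hs : 0 < ((α : ℂ) + t * I).re := by simp; exact hα0
  have hWd := norm_twistMellin_le_decay hs lam
  have hge : ∀ k : ℝ, |t| ≤ ‖(α : ℂ) + t * I + k‖ := by
    intro k
    have : |((α : ℂ) + t * I + k).im| ≤ ‖(α : ℂ) + t * I + k‖ := Complex.abs_im_le_norm _
    simpa using this
  have hprod : |t| ^ 3 ≤ ‖(α : ℂ) + t * I + 2‖ * ‖(α : ℂ) + t * I + 3‖ * ‖(α : ℂ) + t * I + 4‖ := by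
    have h2 := hge 2; have h3 := hge 3; have h4 := hge 4
    push_cast at h2 h3 h4
    calc |t| ^ 3 = |t| * |t| * |t| := by ring
      _ ≤ _ := by
        apply mul_le_mul (mul_le_mul h2 h3 (abs_nonneg _) (norm_nonneg _)) h4 (abs_nonneg _) (by positivity)
  have habs0 : 0 < |t| := lt_of_le_of_lt (by linarith) ht
  rw [norm_scaledKernel he, mul_div_assoc]
  exact mul_le_mul_of_nonneg_left (hWd.trans (div_le_div_of_nonneg_left hCl0 (by positivity) hprod))
    (by positivity)

/-- `‖A_{λ,e}(t) − A_{λ,e}(0)‖ ≤ (2 + 2 log e) e^{−α}/(1+|λ|) · |t|` for `|t| ≤ 1` (`1/2 ≤ α ≤ 1`):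
`A(t) − A(0) = e^{−α}[(e^{−it} − 1)Ŵ(α+it) + (Ŵ(α+it) − Ŵ(α))]`. [folklore] -/
theorem scaledKernel_sub_zero_le {α : ℝ} (hα : 1 / 2 ≤ α) (hα1 : α ≤ 1) {e : ℕ} (he : 1 ≤ e) (lam : ℝ)
    {t : ℝ} (ht : |t| ≤ 1) :
    ‖scaledKernel α e lam t - scaledKernel α e lam 0‖ ≤ (2 + 2 * Real.log e) * (e : ℝ) ^ (-α) / (1 + |lam|) * |t| := by
  have hα0 : 0 < α := by linarith
  have he0 : 0 < e := he
  set ρ : ℝ := (e : ℝ) ^ (-α) with hρ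
  have hρ0 : 0 < ρ := Real.rpow_pos_of_pos (by exact_mod_cast he0) _
  have hW3 : ‖twistMellin lam (α + t * I)‖ ≤ 2 / (1 + |lam|) :=
    norm_twistMellin_le_two_div hα0 hα1 (ht.trans (by norm_num)) lam
  have hvar := norm_twistMellin_sub_le (σ := α) hα t lam
  have hph := norm_natCast_cpow_neg_mul_I_sub_one_le he t
  have hdec : scaledKernel α e lam t - scaledKernel α e lam 0 =
      (e : ℂ) ^ (-(α : ℂ)) * (((e : ℂ) ^ (-((t : ℂ) * I)) - 1) * twistMellin lam (α + t * I) +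
        (twistMellin lam (α + t * I) - twistMellin lam α)) := by
    simp only [scaledKernel]
    rw [natCast_cpow_neg_add he]
    push_cast
    rw [zero_mul, add_zero]
    ring
  have hρC : ‖(e : ℂ) ^ (-(α : ℂ))‖ = ρ := by
    rw [hρ, Complex.norm_natCast_cpow_of_pos he0]; simp
  rw [hdec, norm_mul, hρC]
  calc ρ * ‖((e : ℂ) ^ (-((t : ℂ) * I)) - 1) * twistMellin lam (α + t * I) +
        (twistMellin lam (α + t * I) - twistMellin lam α)‖
      ≤ ρ * (‖(e : ℂ) ^ (-((t : ℂ) * I)) - 1‖ * ‖twistMellin lam (α + t * I)‖ +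
          ‖twistMellin lam (α + t * I) - twistMellin lam α‖) := by
        apply mul_le_mul_of_nonneg_left _ hρ0.le
        rw [← norm_mul]; exact norm_add_le _ _
    _ ≤ ρ * ((|t| * Real.log e) * (2 / (1 + |lam|)) + 2 * |t| / (1 + |lam|)) := by
        apply mul_le_mul_of_nonneg_left _ hρ0.le
        exact add_le_add (mul_le_mul hph hW3 (norm_nonneg _) (by positivity)) hvar
    _ = (2 + 2 * Real.log e) * ρ / (1 + |lam|) * |t| := by ring

/-- **The second symmetric difference of the scaled kernel**:
`‖A_{λ,e}(t) + A_{λ,e}(−t) − 2A_{λ,e}(0)‖ ≤ 2(log e + 3)² e^{−α}/(1+|λ|) · t²` (`1/2 ≤ α ≤ 1`). With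
`E_± = e^{∓it}`, `w_± = Ŵ(α ± it)`, `w₀ = Ŵ(α)`:
`E₊w₊ + E₋w₋ − 2w₀ = (w₊ + w₋ − 2w₀) + (E₊−1)(w₊−w₀) + (E₋−1)(w₋−w₀) + (E₊ + E₋ − 2)w₀`, and the four
pieces are `≤ 15t²`, `2t² log e`, `2t² log e`, `2(t log e)²` over `1+|λ|`. [folklore] -/
theorem scaledKernel_symmDiff_le {α : ℝ} (hα : 1 / 2 ≤ α) (hα1 : α ≤ 1) {e : ℕ} (he : 1 ≤ e) (lam t : ℝ) :
    ‖scaledKernel α e lam t + scaledKernel α e lam (-t) - 2 * scaledKernel α e lam 0‖ ≤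
      2 * (Real.log e + 3) ^ 2 * (e : ℝ) ^ (-α) / (1 + |lam|) * t ^ 2 := by
  have hα0 : 0 < α := by linarith
  have he0 : 0 < e := he
  have hloge : 0 ≤ Real.log e := Real.log_nonneg (by exact_mod_cast he)
  set ρ : ℝ := (e : ℝ) ^ (-α) with hρ
  have hρ0 : 0 < ρ := Real.rpow_pos_of_pos (by exact_mod_cast he0) _
  set P : ℂ := (e : ℂ) ^ (-(α : ℂ)) with hP
  set Ep : ℂ := (e : ℂ) ^ (-((t : ℂ) * I)) with hEp
  set Em : ℂ := (e : ℂ) ^ (-((((-t : ℝ)) : ℂ) * I)) with hEm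
  set wp : ℂ := twistMellin lam (α + t * I) with hwp
  set wm : ℂ := twistMellin lam (α - t * I) with hwm
  set w₀ : ℂ := twistMellin lam α with hw₀
  have harg : (α : ℂ) + (((-t : ℝ)) : ℂ) * I = (α : ℂ) - (t : ℂ) * I := by push_cast; ring
  have hAt : scaledKernel α e lam t = P * Ep * wp := by
    rw [scaledKernel, natCast_cpow_neg_add he]
  have hAm : scaledKernel α e lam (-t) = P * Em * wm := by
    rw [scaledKernel, natCast_cpow_neg_add he, harg]
  have hA0 : scaledKernel α e lam 0 = P * w₀ := by
    rw [scaledKernel, natCast_cpow_neg_add he]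
    push_cast
    rw [zero_mul, add_zero, neg_zero, Complex.cpow_zero, mul_one]
  have hdec : scaledKernel α e lam t + scaledKernel α e lam (-t) - 2 * scaledKernel α e lam 0 =
      P * ((wp + wm - 2 * w₀) + (Ep - 1) * (wp - w₀) + (Em - 1) * (wm - w₀) + (Ep + Em - 2) * w₀) := by
    rw [hAt, hAm, hA0]; ring
  have hPn : ‖P‖ = ρ := by rw [hP, hρ, Complex.norm_natCast_cpow_of_pos he0]; simp
  -- the four pieces
  have k1 : ‖wp + wm - 2 * w₀‖ ≤ 15 * t ^ 2 / (1 + |lam|) := norm_twistMellin_symmDiff_le hα hα1 t lam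
  have hEp1 : ‖Ep - 1‖ ≤ |t| * Real.log e := norm_natCast_cpow_neg_mul_I_sub_one_le he t
  have hEm1 : ‖Em - 1‖ ≤ |t| * Real.log e := by
    have := norm_natCast_cpow_neg_mul_I_sub_one_le he (-t); rwa [abs_neg] at this
  have hwp1 : ‖wp - w₀‖ ≤ 2 * |t| / (1 + |lam|) := norm_twistMellin_sub_le (σ := α) hα t lam
  have hwm1 : ‖wm - w₀‖ ≤ 2 * |t| / (1 + |lam|) := by
    have h := norm_twistMellin_sub_le (σ := α) hα (-t) lam
    rw [abs_neg] at h
    have e1 : (α : ℂ) + (((-t : ℝ)) : ℂ) * I = (α : ℂ) - (t : ℂ) * I := by push_cast; ring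
    rwa [e1] at h
  have hE2 : ‖Ep + Em - 2‖ ≤ (t * Real.log e) ^ 2 := norm_natCast_cpow_symm_sub_two_le he t
  have hw₀ : ‖w₀‖ ≤ 2 / (1 + |lam|) := by
    have := norm_twistMellin_le_two_div hα0 hα1 (t := 0) (by norm_num) lam
    simpa using this
  have k2 : ‖(Ep - 1) * (wp - w₀)‖ ≤ (|t| * Real.log e) * (2 * |t| / (1 + |lam|)) := by
    rw [norm_mul]; exact mul_le_mul hEp1 hwp1 (norm_nonneg _) (by positivity)
  have k3 : ‖(Em - 1) * (wm - w₀)‖ ≤ (|t| * Real.log e) * (2 * |t| / (1 + |lam|)) := by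
    rw [norm_mul]; exact mul_le_mul hEm1 hwm1 (norm_nonneg _) (by positivity)
  have k4 : ‖(Ep + Em - 2) * w₀‖ ≤ (t * Real.log e) ^ 2 * (2 / (1 + |lam|)) := by
    rw [norm_mul]; exact mul_le_mul hE2 hw₀ (norm_nonneg _) (by positivity)
  have ht2 : |t| * |t| = t ^ 2 := by rw [← sq, sq_abs]
  have hl0 : 0 < 1 + |lam| := by positivity
  rw [hdec, norm_mul, hPn]
  have hsum : ‖(wp + wm - 2 * w₀) + (Ep - 1) * (wp - w₀) + (Em - 1) * (wm - w₀) + (Ep + Em - 2) * w₀‖ ≤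
      (15 + 4 * Real.log e + 2 * Real.log e ^ 2) * t ^ 2 / (1 + |lam|) := by
    calc ‖(wp + wm - 2 * w₀) + (Ep - 1) * (wp - w₀) + (Em - 1) * (wm - w₀) + (Ep + Em - 2) * w₀‖
        ≤ ‖(wp + wm - 2 * w₀) + (Ep - 1) * (wp - w₀) + (Em - 1) * (wm - w₀)‖ + ‖(Ep + Em - 2) * w₀‖ :=
          norm_add_le _ _
      _ ≤ ‖(wp + wm - 2 * w₀) + (Ep - 1) * (wp - w₀)‖ + ‖(Em - 1) * (wm - w₀)‖ + ‖(Ep + Em - 2) * w₀‖ := by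
          gcongr; exact norm_add_le _ _
      _ ≤ ‖wp + wm - 2 * w₀‖ + ‖(Ep - 1) * (wp - w₀)‖ + ‖(Em - 1) * (wm - w₀)‖ + ‖(Ep + Em - 2) * w₀‖ := by
          gcongr; exact norm_add_le _ _
      _ ≤ 15 * t ^ 2 / (1 + |lam|) + (|t| * Real.log e) * (2 * |t| / (1 + |lam|)) +
            (|t| * Real.log e) * (2 * |t| / (1 + |lam|)) + (t * Real.log e) ^ 2 * (2 / (1 + |lam|)) := by
          linarith [k1, k2, k3, k4]
      _ = (15 + 4 * Real.log e + 2 * Real.log e ^ 2) * t ^ 2 / (1 + |lam|) := by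
          field_simp
          rw [← ht2]
          ring
  have hcoef : (15 + 4 * Real.log e + 2 * Real.log e ^ 2) * t ^ 2 / (1 + |lam|) ≤
      2 * (Real.log e + 3) ^ 2 * t ^ 2 / (1 + |lam|) := by
    apply div_le_div_of_nonneg_right _ hl0.le
    apply mul_le_mul_of_nonneg_right _ (sq_nonneg t)
    nlinarith
  calc ρ * ‖(wp + wm - 2 * w₀) + (Ep - 1) * (wp - w₀) + (Em - 1) * (wm - w₀) + (Ep + Em - 2) * w₀‖
      ≤ ρ * (2 * (Real.log e + 3) ^ 2 * t ^ 2 / (1 + |lam|)) :=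
        mul_le_mul_of_nonneg_left (hsum.trans hcoef) hρ0.le
    _ = 2 * (Real.log e + 3) ^ 2 * ρ / (1 + |lam|) * t ^ 2 := by ring

/-! ### The scaled twisted sum with a parametric window at second order -/

set_option maxHeartbeats 1000000 in
/-- **The twisted saddle point at the scale `x/e`, parametric window, second order.** With
`𝓜 = x^α ζ(α,y)/√(2πφ)`, `α = α(x,y)`, `φ = φ₂(α,y)`, `W > 0`, `ℓ = log y`, under the range hypotheses
(`W/√φ ≤ π/ℓ ≤ 1`, `Φ₃(W/√φ)³/6 + Φ₄(W/√φ)⁴ ≤ 1`) and the decay of `ζ(α+it,y)/ζ(α,y)` (`≤ ε₁` on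
`π/ℓ ≤ |t| ≤ 3`, `≤ ε₂` on `3 ≤ |t| ≤ T`):
`‖S_w(λ; x/e) − e^{−α} 𝓜 Ŵ_λ(α)‖ ≤ (x^α ζ(α,y)/(2π)) e^{−α} · E₂`, `E₂ =` Gaussian completion
`(2/(1+|λ|))e^{−W²/4}√(4π/φ)` + window `√(4π/φ)(2(log e+3)² + (2+2log e)(15ℓ + 666ℓ²W/√φ) + 916ℓ² + 7·10⁶ℓ⁴/φ)/(φ(1+|λ|))`
+ tails `(2/(1+|λ|))e^{−W²/140}√(125π³/φ) + 20πε₁/(α(1+|λ|)) + 2πε₂T + 2πC_λ/T²`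
(`SaddleKernel.norm_kernelIntegral_sub_main_le_window₂'` for the kernel `A_{λ,e}`).
[cite: HildebrandTenenbaum1986, §4 (Lemmas 10–11)] [cite: Harper2016, §5] -/
theorem norm_scaledSum_sub_main_le_window₂ {x T ε₁ ε₂ W : ℝ} {y : ℕ} (hx : 1 < x) (hy : 2 ≤ y)
    (hα : 3 / 5 ≤ saddlePoint x y) (hα1 : saddlePoint x y ≤ 1) (hφ0 : 0 < saddlePhi₂ (saddlePoint x y) y)
    (hW : 0 < W) (hτ : W / Real.sqrt (saddlePhi₂ (saddlePoint x y) y) ≤ Real.pi / Real.log y)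
    (hy1 : Real.pi / Real.log y ≤ 1)
    (hη₂ : saddlePhi₃ (saddlePoint x y) y / 6 * (W / Real.sqrt (saddlePhi₂ (saddlePoint x y) y)) ^ 3 +
      saddlePhi₄ (saddlePoint x y) y * (W / Real.sqrt (saddlePhi₂ (saddlePoint x y) y)) ^ 4 ≤ 1)
    (hT : 3 ≤ T) (hε₁ : 0 ≤ ε₁) (hε₂ : 0 ≤ ε₂)
    (hdec1 : ∀ t : ℝ, Real.pi / Real.log y ≤ |t| → |t| ≤ 3 →
      ‖smoothZetaC ((saddlePoint x y : ℂ) + t * I) y‖ / smoothZeta (saddlePoint x y) y ≤ ε₁)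
    (hdec2 : ∀ t : ℝ, 3 ≤ |t| → |t| ≤ T →
      ‖smoothZetaC ((saddlePoint x y : ℂ) + t * I) y‖ / smoothZeta (saddlePoint x y) y ≤ ε₂)
    {e : ℕ} (he : 1 ≤ e) (lam : ℝ) :
    ‖(∑ n ∈ Nat.smoothNumbersUpTo ⌊x / e⌋₊ (y + 1), twistWeight lam (n / (x / e))) -
        ((((e : ℝ) ^ (-saddlePoint x y) * (x ^ saddlePoint x y * smoothZeta (saddlePoint x y) y /
            Real.sqrt (2 * Real.pi * saddlePhi₂ (saddlePoint x y) y)) : ℝ)) : ℂ) * twistMellin lam (saddlePoint x y)‖ ≤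
      (x ^ saddlePoint x y * smoothZeta (saddlePoint x y) y / (2 * Real.pi)) * (e : ℝ) ^ (-saddlePoint x y) *
        (2 / (1 + |lam|) * (Real.exp (-(W ^ 2 / 4)) * Real.sqrt (4 * Real.pi / saddlePhi₂ (saddlePoint x y) y)) +
          Real.sqrt (4 * Real.pi / saddlePhi₂ (saddlePoint x y) y) *
            ((2 * (Real.log e + 3) ^ 2 +
              (2 + 2 * Real.log e) * (15 * Real.log y + 666 * Real.log y ^ 2 *
                (W / Real.sqrt (saddlePhi₂ (saddlePoint x y) y))) +
              916 * Real.log y ^ 2 + 7000000 * Real.log y ^ 4 / saddlePhi₂ (saddlePoint x y) y) /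
              (saddlePhi₂ (saddlePoint x y) y * (1 + |lam|))) +
          ((2 / (1 + |lam|)) * Real.exp (-(W ^ 2 / 140)) * Real.sqrt (125 * Real.pi ^ 3 / saddlePhi₂ (saddlePoint x y) y) +
            20 * Real.pi * ε₁ / (saddlePoint x y * (1 + |lam|)) + 2 * Real.pi * ε₂ * T +
            2 * Real.pi * (2 + 6 * (2 * π * |lam|) + 6 * (2 * π * |lam|) ^ 2 + (2 * π * |lam|) ^ 3) / T ^ 2)) := by
  set α : ℝ := saddlePoint x y with hαdef
  have hα0 : 0 < α := by linarith
  have hα12 : 1 / 2 ≤ α := by linarith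
  set φ : ℝ := saddlePhi₂ α y with hφ
  have hx0 : 0 < x := by linarith
  have he0 : 0 < e := he
  have he0' : (0 : ℝ) < e := by exact_mod_cast he0
  have hloge : 0 ≤ Real.log e := Real.log_nonneg (by exact_mod_cast he)
  set c : ℝ := x ^ α * smoothZeta α y / (2 * Real.pi) with hc
  have hc0 : 0 < c := by have := smoothZeta_pos (y := y) hα0; have := Real.pi_pos; positivity
  set ρ : ℝ := (e : ℝ) ^ (-α) with hρ
  have hρ0 : 0 < ρ := Real.rpow_pos_of_pos he0' _
  -- the kernel constants
  set b₀ : ℝ := 2 * ρ / (1 + |lam|) with hb₀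
  set b₁ : ℝ := (2 + 2 * Real.log e) * ρ / (1 + |lam|) with hb₁
  set b₂ : ℝ := 2 * (Real.log e + 3) ^ 2 * ρ / (1 + |lam|) with hb₂
  set Cl : ℝ := 2 + 6 * (2 * π * |lam|) + 6 * (2 * π * |lam|) ^ 2 + (2 * π * |lam|) ^ 3 with hCl
  have hCl0 : 0 ≤ Cl := by have := Real.pi_pos; positivity
  have hB0 : ∀ t : ℝ, |t| ≤ 3 → ‖scaledKernel α e lam t‖ ≤ b₀ := fun t ht =>
    scaledKernel_norm_le_three hα0 hα1 he lam ht
  have hB1 : ∀ t : ℝ, |t| ≤ 1 → ‖scaledKernel α e lam t - scaledKernel α e lam 0‖ ≤ b₁ * |t| := fun t ht =>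
    scaledKernel_sub_zero_le hα12 hα1 he lam ht
  have hB2 : ∀ t : ℝ, |t| ≤ 1 → ‖scaledKernel α e lam t + scaledKernel α e lam (-t) - 2 * scaledKernel α e lam 0‖ ≤
      b₂ * t ^ 2 := fun t _ => scaledKernel_symmDiff_le hα12 hα1 he lam t
  have hBall : ∀ t : ℝ, ‖scaledKernel α e lam t‖ ≤ ρ := fun t => scaledKernel_norm_le hα0 he lam t
  have hB3 : ∀ t : ℝ, T < |t| → ‖scaledKernel α e lam t‖ ≤ ρ * Cl / |t| ^ 3 := fun t ht =>
    scaledKernel_decay hα0 he lam hT ht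
  have hK := SaddleKernel.norm_kernelIntegral_sub_main_le_window₂' hx hy hα hα1 hφ0 hW hτ hy1 hη₂ hT hε₁ hε₂ hdec1
    hdec2 (continuous_scaledKernel hα0 he0 lam) (integrable_scaledKernel hα0 he0 lam) (by positivity)
    (by positivity) (by positivity) hρ0.le (by positivity) hB0 hB1 hB2 hBall hB3
  rw [← hαdef, ← hφ] at hK
  -- `S_w(λ; x/e) = c ∫ f`, `𝓜 = c √(2π/φ)`, `A 0 = e^{-α} Ŵ_λ(α)`
  have hS := scaledSum_eq_integral hx0 hα0 y he0 lam
  have hA0 : scaledKernel α e lam 0 = (ρ : ℂ) * twistMellin lam α := scaledKernel_zero he lam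
  rw [hA0] at hK
  have hmain : x ^ α * smoothZeta α y / Real.sqrt (2 * Real.pi * φ) = c * Real.sqrt (2 * Real.pi / φ) := by
    rw [hc, SaddleKernel.main_const_identity hφ0]
  rw [hmain, hS]
  have halg : (c : ℂ) * (∫ t, scaledIntegrand x α y e lam t) -
      (((ρ * (c * Real.sqrt (2 * Real.pi / φ)) : ℝ)) : ℂ) * twistMellin lam α =
      (c : ℂ) * ((∫ t, SaddleKernel.kernelIntegrand x α y (scaledKernel α e lam) t) -
        (ρ : ℂ) * twistMellin lam α * (Real.sqrt (2 * Real.pi / φ) : ℂ)) := by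
    simp only [scaledIntegrand]
    push_cast; ring
  rw [halg, norm_mul, Complex.norm_real, Real.norm_eq_abs, abs_of_pos hc0]
  rw [show ∀ B : ℝ, c * ρ * B = c * (ρ * B) from fun B => mul_assoc _ _ _]
  apply mul_le_mul_of_nonneg_left (hK.trans (le_of_eq _)) hc0.le
  -- compare the two error expressions (an identity)
  have hl : 0 < 1 + |lam| := by positivity
  rw [hb₀, hb₁, hb₂]
  field_simp
  ring

end TwistedWeight

end Literature.NumberTheory.Sieve

end
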